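import Literature.NumberTheory.Transcendental.PhilipponZeroEstimateExact
import Literature.NumberTheory.Transcendental.GaGmIsogenyIndex
import Literature.NumberTheory.Transcendental.GaGmIsogenyLattice
import Mathlib.LinearAlgebra.LinearIndependent.BaseChange
import Mathlib.LinearAlgebra.Matrix.Rank
import HarnessLib

/-!
# Philippon's zero estimate on `𝔾ₐ × 𝔾ₘⁿ ⊂ (ℙ¹)ⁿ⁺¹` with multiplicities: UNEQUAL torus degrees by
# the isogeny `y_j ↦ y_j^{k_j}`

Topic `Literature/NumberTheory/Transcendental`. The tree proves Philippon's zero estimate on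
`G = 𝔾ₐ × 𝔾ₘⁿ` with the exact constant for the box of bidegree `(D₀, K)` — the SAME degree `K` in
every torus variable (`GaGm.zero_estimate_exact_subgroup`, `PhilipponZeroEstimateExact.lean`).
Nesterenko 2003, Prop. 5.1 (= Waldschmidt 2000, Thm. 8.1) has independent degrees
`(D₀, D₁, …, Dₙ)`. This file performs the reduction: given `Q` with `deg_{Y_j} Q · k_j ≤ K`, the
pulled-back polynomial `φ_k^* Q = Q(X, Y_j^{k_j})` has box degree `(D₀, K)`, vanishes to the same
order along `dφ_k⁻¹(W)` at the points of `φ_k⁻¹(Σ)`, and the equal-degree theorem upstairs yields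
an irreducible subgroup `H' = V × T_{Φ'}`; downstairs we return `H = V × T_Φ`, `Φ = {χ ; kχ ∈ Φ'}`
(`GaGm.ConnAlgSubgroup.isoImage`), with `ℤ`-bases `M` of `Φ` and `M'` of `Φ'` of the same size
`r = n − dim T_{Φ'}` and one natural number `ι = [Φ' : Φ' ∩ kℤⁿ]` such that

* `binom(T + ℓ₀, ℓ₀) · card((Σ·H)/H) · ι · mult_{D₀,K}(H') ≤ (n+1)! D₀ Kⁿ`
  (`ℓ₀ = dim W − dim(W ∩ Lie H) = dim dφ⁻¹W − dim(dφ⁻¹W ∩ Lie H')`; the coset count downstairs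
  times `[ker φ_k : ker φ_k ∩ H'] ≥ ι` is at most the coset count upstairs,
  `GaGm.relIndex_mul_ncard_image_le`, `GaGm.relIndex_range_kmulHom_le`), and
* `|det M_I| · ∏_{i∈I} k_i = ι · |det M'_I|` for every `I` (`GaGm.exists_basis_comap_kmulHom`).

With a formula `mult_{D₀,K}(H') ≥ (d₀ + n − r)! D₀^{d₀} K^{n−r} ∑_I |det M'_I|` for the box
multiplicity of a connected subgroup (the tree's `GaGm.factorial_mul_sum_slice_le_mult` and its
sequel) this is `Nesterenko2003_prop51` after cancelling `Kⁿ` (`K = k_j D_j`). PROVED here: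
`GaGm.finrank_tangentOf_add_eq` (`dim T_Φ + rank Φ = n` for a `ℤ`-basis of `Φ`) and
**`GaGm.zero_estimate_isogeny`**. No named facts, no new definitions.

## References

* Yu. V. Nesterenko, *Linear forms in logarithms of rational numbers*, LNM 1819 (2003), §5.1,
  Prop. 5.1 and (5.7).
* M. Waldschmidt, *Diophantine Approximation on Linear Algebraic Groups*, Grundlehren 326 (2000),
  Thm. 8.1.
* P. Philippon, *Lemmes de zéros dans les groupes algébriques commutatifs*, Bull. Soc. Math.
  France 114 (1986), 355–383, Thm. 2.1.
-/

noncomputable section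

open MvPolynomial Module
open scoped Pointwise

namespace Literature.NumberTheory.Transcendental

namespace GaGm

variable {n : ℕ}

/-! ### The dimension of `T_Φ` from a `ℤ`-basis of `Φ` -/

/-- **`dim Lie T_Φ + rank Φ = n`**: for a subgroup `Φ ≤ ℤⁿ` with a `ℤ`-basis given by the rows of
`M ∈ M_{r×n}(ℤ)`, the annihilator `{v ∈ ℂⁿ ; ⟨χ, v⟩ = 0 ∀ χ ∈ Φ}` (`GaGm.tangentOf`, the Lie
algebra of `T_Φ`) has dimension `n − r` (rank–nullity for `M ⊗ ℂ`, whose rows stay independent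
over `ℂ`). [cite: Nesterenko2003, §5.1 (`d* = d₀ + n − r`)] -/
theorem finrank_tangentOf_add_eq {r : ℕ} {A : AddSubgroup (Fin n → ℤ)} (M : Matrix (Fin r) (Fin n) ℤ)
    (hli : LinearIndependent ℤ (fun i => M i)) (hsp : A = AddSubgroup.closure (Set.range fun i => M i)) :
    finrank ℂ ↥(tangentOf A) + r = n := by
  classical
  set MC : Matrix (Fin r) (Fin n) ℂ := Matrix.of fun i j => (M i j : ℂ) with hMC
  have hrow : ∀ (i : Fin r) (v : Fin n → ℂ), (MC.mulVec v) i = ∑ j, (M i j : ℂ) * v j := fun i v => by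
    simp [Matrix.mulVec, dotProduct, hMC]
  have hker : LinearMap.ker MC.mulVecLin = tangentOf A := by
    ext v
    simp only [LinearMap.mem_ker, Matrix.mulVecLin_apply]
    constructor
    · intro hv χ hχ
      rw [hsp] at hχ
      refine AddSubgroup.closure_induction (p := fun χ _ => ∑ j, (χ j : ℂ) * v j = 0) ?_ ?_ ?_ ?_ hχ
      · rintro _ ⟨i, rfl⟩
        have := congrFun hv i
        rw [hrow] at this
        simpa using this
      · simp
      · intro x y _ _ hx hy
        simp only [Pi.add_apply, Int.cast_add, add_mul, Finset.sum_add_distrib, hx, hy, add_zero]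
      · intro x _ hx
        simp only [Pi.neg_apply, Int.cast_neg, neg_mul, Finset.sum_neg_distrib, hx, neg_zero]
    · intro hv
      funext i
      rw [hrow, Pi.zero_apply]
      exact hv (M i) (by rw [hsp]; exact AddSubgroup.subset_closure ⟨i, rfl⟩)
  have hrank : MC.rank = r := by
    rw [Matrix.rank_eq_finrank_span_row]
    have hrows : LinearIndependent ℂ (fun i => MC.row i) := by
      have h := (linearIndependent_algebraMap_comp_iff (R := ℤ) (S := ℂ) (v := fun i => M i)).mpr hli
      have e : (fun i => MC.row i) = fun i => ⇑(algebraMap ℤ ℂ) ∘ M i := by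
        funext i
        funext j
        simp [Matrix.row, hMC]
      rw [e]
      exact h
    rw [finrank_span_eq_card hrows, Fintype.card_fin]
  have hrn := LinearMap.finrank_range_add_finrank_ker MC.mulVecLin
  rw [hker, Module.finrank_fin_fun] at hrn
  change MC.rank + finrank ℂ ↥(tangentOf A) = n at hrn
  omega

/-! ### The reduction -/

/-- **Philippon's zero estimate on `G = 𝔾ₐ × 𝔾ₘⁿ` with multiplicities and UNEQUAL torus degrees,
through the isogeny `φ_k(x, y) = (x, y_j^{k_j})`** (the reduction behind Nesterenko 2003,
Prop. 5.1 / Waldschmidt 2000, Thm. 8.1, over the tree's equal-degree theorem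
`GaGm.zero_estimate_exact_subgroup`). Data: `D₀ ≥ 1`, `K ≥ 1`, `k_j ≥ 1`, `W ≤ Lie G`, a finite
`Σ ∋ e`, and `Q ≠ 0` with `deg_X Q ≤ D₀`, `k_j · deg_{Y_j} Q ≤ K`, vanishing to order `≥ (n+1)T + 1`
along `exp_G(W)` on `Σ(n+1)`. Conclusion: an irreducible closed subgroup `H'` (the obstruction for
`φ_k^*Q` upstairs, `dim H' ≤ n`), the connected subgroup `H = V × T_Φ` downstairs
(`Φ = {χ ; kχ ∈ Φ'}`, `Φ' = X(H')^⊥`, same additive part), `ℤ`-bases `M` of `Φ` and `M'` of `Φ'`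
with `r` rows, `r + dim T_{Φ'} = n`, and `ι ∈ ℕ` with: the `ℓ₀`-identity
`dim W − dim(W ∩ Lie H) = dim W' − dim(W' ∩ Lie H')` (`W' = dφ_k⁻¹ W`); the minors identity
`|det M_I| · ∏_{i∈I} k_i = ι · |det M'_I|`; and
`binom(T + ℓ₀, ℓ₀) · card((Σ·H)/H) · ι · mult_{D₀,K}(H') ≤ (n+1)! · D₀ · Kⁿ`.
[cite: Nesterenko2003, Prop 5.1] [cite: Waldschmidt2000GL326, Thm 8.1] -/
theorem zero_estimate_isogeny {D₀ K T : ℕ} (k : Fin n → ℕ) (hk : ∀ j, 1 ≤ k j)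
    (W : Submodule ℂ (ℂ × (Fin n → ℂ))) {S : Set (GaGm n)} {Q : MvPolynomial (Fin (n + 1)) ℂ}
    (hD₀ : 1 ≤ D₀) (hK : 1 ≤ K) (hS : S.Finite) (h1 : (1 : GaGm n) ∈ S) (hQ0 : Q ≠ 0)
    (hdeg0 : Q.degreeOf 0 ≤ D₀) (hdeg : ∀ j : Fin n, k j * Q.degreeOf j.succ ≤ K)
    (hvan : ∀ g ∈ sumset S (n + 1), VanishesToOrder Q W g ((n + 1) * T + 1)) :
    ∃ (H' : Subgroup (GaGm n)) (hirr' : IsIrred (H' : Set (GaGm n))) (H : ConnAlgSubgroup n) (r : ℕ)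
      (M M' : Matrix (Fin r) (Fin n) ℤ) (ι : ℕ),
      (LinearIndependent ℤ (fun i => M i) ∧ H.chars = AddSubgroup.closure (Set.range fun i => M i)) ∧
      (LinearIndependent ℤ (fun i => M' i) ∧
        charGroup (H' : Set (GaGm n)) = AddSubgroup.closure (Set.range fun i => M' i)) ∧
      (H.addDim = (toConnAlgSubgroup H' hirr').addDim ∧ r + (toConnAlgSubgroup H' hirr').torusDim = n) ∧
      dimG (H' : Set (GaGm n)) ≤ n ∧
      (∀ h ∈ H', powMap k h ∈ H.toSubgroup) ∧
      finrank ℂ ↥W - finrank ℂ ↥(W ⊓ H.tangent) =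
        finrank ℂ ↥(W.comap (powLin k)) - finrank ℂ ↥(W.comap (powLin k) ⊓ (toConnAlgSubgroup H' hirr').tangent) ∧
      (∀ I : Finset (Fin n), absMinor M I * ∏ j ∈ I, k j = ι * absMinor M' I) ∧
      Nat.choose (T + (finrank ℂ ↥W - finrank ℂ ↥(W ⊓ H.tangent))) (finrank ℂ ↥W - finrank ℂ ↥(W ⊓ H.tangent)) *
          Set.ncard ((QuotientGroup.mk : GaGm n → GaGm n ⧸ H.toSubgroup) '' S) * ι *
        mult D₀ K (H' : Set (GaGm n)) ≤ (n + 1).factorial * D₀ * K ^ n := by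
  classical
  -- the data upstairs
  set W' : Submodule ℂ (ℂ × (Fin n → ℂ)) := W.comap (powLin k) with hW'
  set S' : Set (GaGm n) := powMap k ⁻¹' S with hS'def
  set Q' : MvPolynomial (Fin (n + 1)) ℂ := pullPoly k Q with hQ'
  have hS' : S'.Finite := finite_preimage_powMap hk hS
  have h1' : (1 : GaGm n) ∈ S' := by
    show powMap k 1 ∈ S
    rw [map_one]; exact h1
  have hQ'0 : Q' ≠ 0 := pullPoly_ne_zero hk hQ0
  have hQ'B : Q' ∈ Box (n := n) D₀ K 1 := by
    rw [mem_Box_iff, one_mul, one_mul]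
    refine ⟨(degreeOf_pullPoly_zero_le hk Q).trans hdeg0, fun j => ?_⟩
    exact (degreeOf_pullPoly_succ_le hk Q j).trans (hdeg j)
  have hvan' : ∀ g ∈ sumset S' (n + 1), VanishesToOrder Q' W' g ((n + 1) * T + 1) := fun g hg =>
    vanishesToOrder_pullPoly hk (hvan _ (powMap_mem_sumset k (S := S) (S' := S') le_rfl hg))
  -- the equal-degree zero estimate upstairs
  obtain ⟨H', hirr', hdim', -, hineq'⟩ := zero_estimate_exact_subgroup W' hD₀ hK hS' h1' hQ'0 hQ'B hvan'
  set K' : ConnAlgSubgroup n := toConnAlgSubgroup H' hirr' with hK'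
  have hK'H : K'.toSubgroup = H' := toSubgroup_toConnAlgSubgroup H' hirr'
  set Φ' : AddSubgroup (Fin n → ℤ) := charGroup (H' : Set (GaGm n)) with hΦ'
  have hΦ'K : K'.chars = Φ' := rfl
  -- the subgroup downstairs
  set H : ConnAlgSubgroup n := ConnAlgSubgroup.isoImage k K' with hH
  have hHsub : ∀ h ∈ H', powMap k h ∈ H.toSubgroup := fun h hh =>
    ConnAlgSubgroup.powMap_mem_isoImage k K' (by rw [hK'H]; exact hh)
  -- bases: `M'` of `Φ'`, `M` of `Φ = H.chars`
  obtain ⟨r, b'⟩ := Submodule.basisOfPid (Pi.basisFun ℤ (Fin n)) Φ'.toIntSubmodule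
  set M' : Matrix (Fin r) (Fin n) ℤ := Matrix.of fun i j => ((b' i : ↥Φ'.toIntSubmodule) : Fin n → ℤ) j
    with hM'
  have hM'i : ∀ i, M' i = ((b' i : ↥Φ'.toIntSubmodule) : Fin n → ℤ) := fun i => by
    funext j; rw [hM', Matrix.of_apply]
  have hM'row : (fun i => M' i) = fun i => ((b' i : ↥Φ'.toIntSubmodule) : Fin n → ℤ) := funext hM'i
  have hli' : LinearIndependent ℤ (fun i => M' i) := by
    rw [hM'row]; exact rows_linearIndependent_of_basis b'
  have hsp' : Φ' = AddSubgroup.closure (Set.range fun i => M' i) := by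
    rw [hM'row]; exact closure_rows_of_basis b'
  obtain ⟨M, hli, hsp, hminors⟩ := exists_basis_comap_kmulHom hk M' hli' hsp'
  have hchars : H.chars = AddSubgroup.closure (Set.range fun i => M i) := by
    rw [← hsp, hH, ConnAlgSubgroup.chars_isoImage, hΦ'K]
  -- the index of the pulled-back lattice and the coset counts
  set ι : ℕ := (kmulHom k).range.relIndex Φ' with hι
  have hιle : ι ≤ H'.relIndex (powMap k).ker := relIndex_range_kmulHom_le hk H'
  have hcount := relIndex_mul_ncard_image_le hk (H' := H') (H := H.toSubgroup) hHsub hS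
  -- dimensions
  have hrt : r + K'.torusDim = n := by
    rw [ConnAlgSubgroup.torusDim, torusTangent_eq_tangentOf, hΦ'K, add_comm]
    exact finrank_tangentOf_add_eq M' hli' hsp'
  have hℓ : finrank ℂ ↥W - finrank ℂ ↥(W ⊓ H.tangent) = finrank ℂ ↥W' - finrank ℂ ↥(W' ⊓ K'.tangent) := by
    rw [hH, hW']
    exact codim_isoImage hk K' W
  refine ⟨H', hirr', H, r, M, M', ι, ⟨hli, hchars⟩, ⟨hli', hsp'⟩, ⟨rfl, hrt⟩, hdim', hHsub, hℓ, hminors, ?_⟩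
  -- the inequality
  set ℓ₀ := finrank ℂ ↥W - finrank ℂ ↥(W ⊓ H.tangent) with hℓ₀
  rw [← hℓ] at hineq'
  set X := Set.ncard ((QuotientGroup.mk : GaGm n → GaGm n ⧸ H.toSubgroup) '' S) with hX
  set X' := Set.ncard ((QuotientGroup.mk : GaGm n → GaGm n ⧸ H') '' S') with hX'
  have hXX : X * ι ≤ X' :=
    calc X * ι ≤ X * H'.relIndex (powMap k).ker := Nat.mul_le_mul_left _ hιle
      _ = H'.relIndex (powMap k).ker * X := mul_comm _ _
      _ ≤ X' := hcount
  calc (T + ℓ₀).choose ℓ₀ * X * ι * mult D₀ K (H' : Set (GaGm n))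
      = (T + ℓ₀).choose ℓ₀ * (X * ι) * mult D₀ K (H' : Set (GaGm n)) := by ring
    _ ≤ (T + ℓ₀).choose ℓ₀ * X' * mult D₀ K (H' : Set (GaGm n)) :=
        Nat.mul_le_mul_right _ (Nat.mul_le_mul_left _ hXX)
    _ ≤ (n + 1).factorial * D₀ * K ^ n := hineq'

end GaGm

end Literature.NumberTheory.Transcendental
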